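import Literature.AnabelianGeometry.EtaleTheta.RealificationUniversal
import Literature.AlgebraicGeometry.Frobenioids.PerfectionPrimes
import Literature.AlgebraicGeometry.Frobenioids.RealPowNNRealLinear
import HarnessLib

/-!
# Frobenioids I, Def. 2.4 (i) / Thm. 6.4 (i): `ℝ_{≥0}`-valued degree maps extend UNIQUELY to the realification

Mochizuki, *The geometry of Frobenioids I*, Kyushu J. Math. **62** (2008), Def. 2.4 (i) p. 48 (the realification
`M^rlf`; "`(M^rlf)^gp` … is an `ℝ`-vector space") and Thm. 6.4 (i), kurims p. 115 l. 27–28 ("the homomorphism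
`(Φ^rlf)^gp(L) = ArithDiv_ℝ(L) → ℝ` given by `deg_L^arith`": the degree on `Φ(L)` is used on `Φ^rlf(L)` through its
canonical `ℝ`-linear extension) [cite: MochizukiFrdI2008, Def. 2.4(i) p.48] [cite: MochizukiFrdI2008, Thm. 6.4 (i) p.115];
the universal property used is [EtTh] Lem. 3.5 (tree: `RlfUniversal.existsUnique_lift`, seat abc-iut-L2-d2).

PROOF-ONLY.  For a perf-factorial monoid `M` and a homomorphism `d : M → ℝ_{≥0}` (an "`ℝ_{≥0}`-valued degree"):
* `IsPerfFactorial.perfectionExtend_spec` — `d` extends to `M^pf → ℝ_{≥0}` (`ℝ_{≥0}` is perfect), uniquely;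
* **`IsPerfFactorial.Rlf.existsUnique_hom_extending`** — there is a UNIQUE homomorphism `φ : M^rlf → ℝ_{≥0}` with
  `φ(ι a) = d(a)` for all `a ∈ M` (`ι : M → M^pf → M^rlf`); by `IsPerfFactorial.Rlf.hom_nnreal_rpow`
  (`RealPowNNRealLinear.lean`, not restated here) it is automatically `ℝ_{≥0}`-linear: `φ(x^r) = r · φ(x)`.
The hypothesis "`ℝ` supports `ℝ_{≥0}`" is taken by name (`hR`; tree: `supports_R_nnreal`, `Thm36SubProofs2.lean`).
Seat abc-iut-L1-d2 (cell abc-iut).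
-/

noncomputable section

namespace Literature.AlgebraicGeometry.Frobenioids

open Function NNReal Literature.AnabelianGeometry.EtaleTheta

namespace IsPerfFactorial

-- `M` in `Type`: the target `ℝ_{≥0}` lives in `Type` and the tree's `Perfection.map` / `RlfUniversal` are
-- universe-homogeneous.
variable {M : Type} [CommMonoid M] (h : IsPerfFactorial M)

/-- The extension of `d : M → ℝ_{≥0}` to `M^pf`: `a^{1/n} ↦ d(a)/n` (additively), i.e.
`(ℝ_{≥0} ≅ ℝ_{≥0}^pf)⁻¹ ∘ d^pf`. [cite: MochizukiFrdI2008, Def. 2.4(i) p.48] -/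
theorem perfectionExtend_spec (d : M →* Multiplicative ℝ≥0) :
    (isPerfect_multiplicative_nnreal.equivPerfection.symm.toMonoidHom.comp (Perfection.map d)).comp
        (Perfection.of M) = d := by
  refine MonoidHom.ext fun a => ?_
  show isPerfect_multiplicative_nnreal.equivPerfection.symm (Perfection.map d (Perfection.of M a)) = d a
  rw [show Perfection.map d (Perfection.of M a) = Perfection.of _ (d a) from
      DFunLike.congr_fun (Perfection.map_comp_of d) a,
    ← IsPerfect.equivPerfection_apply isPerfect_multiplicative_nnreal, MulEquiv.symm_apply_apply]

/-- A homomorphism `M^pf → ℝ_{≥0}` is determined by its restriction to `M` (roots are unique in `ℝ_{≥0}`).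
[cite: MochizukiFrdI2008, Def. 2.4(i) p.48] -/
theorem perfection_hom_ext_of {ψ ψ' : Perfection M →* Multiplicative ℝ≥0}
    (hψ : ψ.comp (Perfection.of M) = ψ'.comp (Perfection.of M)) : ψ = ψ' := by
  refine MonoidHom.ext fun b => ?_
  obtain ⟨⟨a, n⟩, rfl⟩ := Perfection.mk_surjective b
  dsimp only
  have hn : ∀ (x y : Multiplicative ℝ≥0), x ^ (n : ℕ) = y ^ (n : ℕ) → x = y := by
    intro x y hxy
    have := congrArg Multiplicative.toAdd hxy
    rw [toAdd_pow, toAdd_pow] at this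
    exact Multiplicative.toAdd.injective
      ((nsmul_right_injective (n.ne_zero)) this)
  have key : ψ (Perfection.mk a n) ^ (n : ℕ) = ψ' (Perfection.mk a n) ^ (n : ℕ) := by
    rw [← map_pow, ← map_pow, Perfection.mk_pow_self]
    exact DFunLike.congr_fun hψ a
  exact hn _ _ key

namespace Rlf

/-- **`ℝ_{≥0}`-valued degrees extend uniquely to `M^rlf`.**  For a perf-factorial `M` and `d : M → ℝ_{≥0}`
there is a unique homomorphism `φ : M^rlf → ℝ_{≥0}` with `φ ∘ ι = d`, `ι : M → M^rlf` (given that `ℝ` supports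
`ℝ_{≥0}`, `hR`); it is `ℝ_{≥0}`-linear by `hom_nnreal_rpow`.  (Print: "`(Φ^rlf)^gp(L) = ArithDiv_ℝ(L) → ℝ`
given by `deg_L^arith`".) [cite: MochizukiFrdI2008, Thm. 6.4 (i) p.115] -/
theorem existsUnique_hom_extending (hR : Supports (Multiplicative ℝ≥0) MonoidType.R)
    (d : M →* Multiplicative ℝ≥0) :
    ∃! φ : h.Rlf →* Multiplicative ℝ≥0, φ.comp (h.toRealification.comp (Perfection.of M)) = d := by
  let dpf : Perfection M →* Multiplicative ℝ≥0 :=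
    isPerfect_multiplicative_nnreal.equivPerfection.symm.toMonoidHom.comp (Perfection.map d)
  have hdpf : dpf.comp (Perfection.of M) = d := perfectionExtend_spec d
  obtain ⟨φ, hφ, huniq⟩ := RlfUniversal.existsUnique_lift h hR dpf
  refine ⟨φ, ?_, fun ψ hψ => huniq ψ ?_⟩
  · show φ.comp (h.toRealification.comp (Perfection.of M)) = d
    rw [← MonoidHom.comp_assoc, hφ, hdpf]
  · -- `ψ ∘ toRealification = dpf`: both restrict to `d` on `M`
    show ψ.comp h.toRealification = dpf
    apply perfection_hom_ext_of
    rw [MonoidHom.comp_assoc]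
    exact hψ.trans hdpf.symm

end Rlf

end IsPerfFactorial

end Literature.AlgebraicGeometry.Frobenioids
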